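import Mathlib
import HarnessLib

/-!
# Route `ColdStartUniversality` (fixed-cut-off SZZ dynamics, sampler package): the MARTINGALE CENTRAL LIMIT MECHANISM, part 1 —
# Taylor bounds for `e^(iy)` and the passage from NON-NEGATIVE to SIGNED and COMPLEX weights

Helper file (seat `ym-line-csu-p1`, g35; `--supports stmt-QuantumFields-24809`).  Generic probability, no SZZ object.  The Markov property of
the SZZ solutions (file 44) delivers statements of the form `E[Z·f] = 0` or `|E[Z·f]| ≤ η E[Z]` for every bounded NON-NEGATIVE weight `Z`
measurable for a past σ-algebra `ℱ`; the characteristic-function proof of the central limit theorem (next files) needs them for the COMPLEX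
`ℱ`-measurable weights `W_k = exp(iθ S_k + θ² V_k/2)`.  This file provides the bridge and the elementary Taylor bounds:
* `norm_cexp_mul_I_sub_taylor_le` (`|e^(iy) − 1 − iy − (iy)²/2| ≤ |y|³ e^|y|`, from Mathlib's `Complex.norm_exp_sub_sum_le_norm_mul_exp`),
  `norm_cexp_mul_I_sub_cexp_mul_I_le` (`|e^(ia) − e^(ib)| ≤ |a − b|`);
* ★ `abs_integral_mul_le_of_nonneg_weights` — `|∫ Z f| ≤ η ∫ Z` for all bounded non-negative `ℱ`-measurable `Z` ⇒ `|∫ Z f| ≤ η ∫ |Z|` for all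
  bounded `ℱ`-measurable real `Z` (`Z = Z⁺ − Z⁻`);
* ★ `norm_integral_cmul_le_of_nonneg_weights` — the same ⇒ `‖∫ W f‖ ≤ 2ηM` for every bounded `ℱ`-measurable complex `W`, `‖W‖ ≤ M`.
THEOREMS ONLY, no definition, no sorry; [folklore].  HONEST FRAMING: plumbing for fixed-cut-off sampler statements; `UniformColdStartMixing` (24809) is NOT restated; no crux, rung or summit
statement is proved; the Yang–Mills mass gap is NOT proved.
-/

set_option autoImplicit false

noncomputable section

namespace Summit.QuantumFields.YangMills.Theorems.ColdStartUniversality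

open MeasureTheory ProbabilityTheory Filter Topology Finset
open scoped NNReal ENNReal BigOperators

/-! ## §1. Elementary exponential inequalities -/

/-- Third-order Taylor bound for `e^(iy)`: `|e^(iy) − 1 − iy − (iy)²/2| ≤ |y|³ e^|y|`. [folklore] -/
theorem norm_cexp_mul_I_sub_taylor_le (y : ℝ) :
    ‖Complex.exp ((y : ℂ) * Complex.I) - 1 - (y : ℂ) * Complex.I - ((y : ℂ) * Complex.I) ^ 2 / 2‖ ≤
      |y| ^ 3 * Real.exp |y| := by
  have h := Complex.norm_exp_sub_sum_le_norm_mul_exp ((y : ℂ) * Complex.I) 3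
  have hsum : ∑ m ∈ Finset.range 3, ((y : ℂ) * Complex.I) ^ m / (m.factorial : ℂ) =
      1 + (y : ℂ) * Complex.I + ((y : ℂ) * Complex.I) ^ 2 / 2 := by
    simp only [Finset.sum_range_succ, Finset.sum_range_zero, Nat.factorial, pow_zero, pow_one]
    push_cast
    ring
  have hn : ‖(y : ℂ) * Complex.I‖ = |y| := by simp
  rw [hsum, hn] at h
  have heq : Complex.exp ((y : ℂ) * Complex.I) - 1 - (y : ℂ) * Complex.I - ((y : ℂ) * Complex.I) ^ 2 / 2 =
      Complex.exp ((y : ℂ) * Complex.I) - (1 + (y : ℂ) * Complex.I + ((y : ℂ) * Complex.I) ^ 2 / 2) := by ring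
  rwa [heq]

/-- `|e^(ia) − e^(ib)| ≤ |a − b|` for real `a, b`. [folklore] -/
theorem norm_cexp_mul_I_sub_cexp_mul_I_le (a b : ℝ) :
    ‖Complex.exp ((a : ℂ) * Complex.I) - Complex.exp ((b : ℂ) * Complex.I)‖ ≤ |a - b| := by
  have h1 : Complex.exp ((a : ℂ) * Complex.I) - Complex.exp ((b : ℂ) * Complex.I) =
      Complex.exp ((b : ℂ) * Complex.I) * (Complex.exp (Complex.I * ((a - b : ℝ) : ℂ)) - 1) := by
    rw [mul_sub, mul_one, ← Complex.exp_add]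
    push_cast
    ring_nf
  rw [h1, norm_mul, Complex.norm_exp_ofReal_mul_I, one_mul]
  have h2 := Real.norm_exp_I_mul_ofReal_sub_one_le (x := a - b)
  rwa [Real.norm_eq_abs] at h2

/-! ## §2. Weights: from non-negative weights to signed and complex weights -/

/-- If `|∫ Z·f| ≤ η ∫ Z` for every bounded NON-NEGATIVE `ℱ`-measurable weight `Z`, then `|∫ Z·f| ≤ η ∫ |Z|` for every bounded
`ℱ`-measurable real weight `Z` (split `Z = Z⁺ − Z⁻`). [folklore] -/
theorem abs_integral_mul_le_of_nonneg_weights {Ω : Type*} {ℱ mΩ : MeasurableSpace Ω} {P : Measure Ω} [IsFiniteMeasure P]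
    (hℱ : ℱ ≤ mΩ)
    {f : Ω → ℝ} (hfm : Measurable f) {Cf : ℝ} (hfb : ∀ ω, |f ω| ≤ Cf) {η : ℝ}
    (hf : ∀ Z : Ω → ℝ, Measurable[ℱ] Z → (∀ ω, 0 ≤ Z ω) → (∃ C : ℝ, ∀ ω, Z ω ≤ C) →
      |∫ ω, Z ω * f ω ∂P| ≤ η * ∫ ω, Z ω ∂P)
    {Z : Ω → ℝ} (hZ : Measurable[ℱ] Z) {C : ℝ} (hZb : ∀ ω, |Z ω| ≤ C) :
    |∫ ω, Z ω * f ω ∂P| ≤ η * ∫ ω, |Z ω| ∂P := by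
  have hZm : Measurable Z := hZ.mono hℱ le_rfl
  set Zp : Ω → ℝ := fun ω => max (Z ω) 0 with hZp
  set Zm : Ω → ℝ := fun ω => max (-Z ω) 0 with hZm'
  have hZpF : Measurable[ℱ] Zp := hZ.max measurable_const
  have hZmF : Measurable[ℱ] Zm := hZ.neg.max measurable_const
  have hZp0 : ∀ ω, 0 ≤ Zp ω := fun ω => le_max_right _ _
  have hZm0 : ∀ ω, 0 ≤ Zm ω := fun ω => le_max_right _ _
  have hZpb : ∀ ω, Zp ω ≤ C := fun ω => max_le ((le_abs_self _).trans (hZb ω)) ((abs_nonneg _).trans (hZb ω))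
  have hZmb : ∀ ω, Zm ω ≤ C := fun ω => max_le ((neg_le_abs _).trans (hZb ω)) ((abs_nonneg _).trans (hZb ω))
  have h1 := hf Zp hZpF hZp0 ⟨C, hZpb⟩
  have h2 := hf Zm hZmF hZm0 ⟨C, hZmb⟩
  have hsplit : ∀ ω, Z ω = Zp ω - Zm ω := fun ω => by
    simp only [hZp, hZm']
    rcases le_total 0 (Z ω) with h | h
    · rw [max_eq_left h, max_eq_right (by linarith), sub_zero]
    · rw [max_eq_right h, max_eq_left (by linarith)]; ring
  have habs : ∀ ω, |Z ω| = Zp ω + Zm ω := fun ω => by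
    simp only [hZp, hZm']
    rcases le_total 0 (Z ω) with h | h
    · rw [max_eq_left h, max_eq_right (by linarith), add_zero, abs_of_nonneg h]
    · rw [max_eq_right h, max_eq_left (by linarith), zero_add, abs_of_nonpos h]
  have hInt : ∀ {g : Ω → ℝ} {Cg : ℝ}, Measurable g → (∀ ω, |g ω| ≤ Cg) → Integrable g P :=
    fun {g Cg} hg hgb => (integrable_const Cg).mono' hg.aestronglyMeasurable
      (Eventually.of_forall fun ω => by rw [Real.norm_eq_abs]; exact hgb ω)
  have hZpm : Measurable Zp := hZpF.mono hℱ le_rfl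
  have hZmm : Measurable Zm := hZmF.mono hℱ le_rfl
  have hZpab : ∀ ω, |Zp ω| ≤ C := fun ω => by rw [abs_of_nonneg (hZp0 ω)]; exact hZpb ω
  have hZmab : ∀ ω, |Zm ω| ≤ C := fun ω => by rw [abs_of_nonneg (hZm0 ω)]; exact hZmb ω
  have i1 : Integrable (fun ω => Zp ω * f ω) P := hInt (hZpm.mul hfm) fun ω => by
    rw [abs_mul]; exact mul_le_mul (hZpab ω) (hfb ω) (abs_nonneg _) ((abs_nonneg _).trans (hZpab ω))
  have i2 : Integrable (fun ω => Zm ω * f ω) P := hInt (hZmm.mul hfm) fun ω => by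
    rw [abs_mul]; exact mul_le_mul (hZmab ω) (hfb ω) (abs_nonneg _) ((abs_nonneg _).trans (hZmab ω))
  have i3 : Integrable Zp P := hInt hZpm hZpab
  have i4 : Integrable Zm P := hInt hZmm hZmab
  have heq : ∫ ω, Z ω * f ω ∂P = (∫ ω, Zp ω * f ω ∂P) - ∫ ω, Zm ω * f ω ∂P := by
    rw [← integral_sub i1 i2]
    exact integral_congr_ae (ae_of_all _ fun ω => by
      show Z ω * f ω = Zp ω * f ω - Zm ω * f ω
      rw [hsplit ω]; ring)
  have heq2 : ∫ ω, |Z ω| ∂P = (∫ ω, Zp ω ∂P) + ∫ ω, Zm ω ∂P := by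
    rw [← integral_add i3 i4]
    exact integral_congr_ae (ae_of_all _ fun ω => habs ω)
  rw [heq, heq2, mul_add]
  exact (abs_sub _ _).trans (add_le_add h1 h2)


/-- Complex weights: if `|∫ Z·f| ≤ η ∫ Z` for every bounded non-negative `ℱ`-measurable `Z` (`η ≥ 0`), then for every bounded
`ℱ`-measurable COMPLEX weight `W` with `‖W‖ ≤ M` on a probability space, `‖∫ W·f‖ ≤ 2ηM` (real and imaginary parts). [folklore] -/
theorem norm_integral_cmul_le_of_nonneg_weights {Ω : Type*} {ℱ mΩ : MeasurableSpace Ω} {P : Measure Ω} [IsProbabilityMeasure P]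
    (hℱ : ℱ ≤ mΩ) {f : Ω → ℝ} (hfm : Measurable f) {Cf : ℝ} (hfb : ∀ ω, |f ω| ≤ Cf) {η : ℝ} (hη : 0 ≤ η)
    (hf : ∀ Z : Ω → ℝ, Measurable[ℱ] Z → (∀ ω, 0 ≤ Z ω) → (∃ C : ℝ, ∀ ω, Z ω ≤ C) →
      |∫ ω, Z ω * f ω ∂P| ≤ η * ∫ ω, Z ω ∂P)
    {W : Ω → ℂ} (hW : Measurable[ℱ] W) {M : ℝ} (hWb : ∀ ω, ‖W ω‖ ≤ M) :
    ‖∫ ω, W ω * (f ω : ℂ) ∂P‖ ≤ 2 * η * M := by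
  have hWm : Measurable W := hW.mono hℱ le_rfl
  have hReF : Measurable[ℱ] fun ω => (W ω).re := Complex.measurable_re.comp hW
  have hImF : Measurable[ℱ] fun ω => (W ω).im := Complex.measurable_im.comp hW
  have hReb : ∀ ω, |(W ω).re| ≤ M := fun ω => (Complex.abs_re_le_norm _).trans (hWb ω)
  have hImb : ∀ ω, |(W ω).im| ≤ M := fun ω => (Complex.abs_im_le_norm _).trans (hWb ω)
  have h1 := abs_integral_mul_le_of_nonneg_weights hℱ hfm hfb hf hReF hReb
  have h2 := abs_integral_mul_le_of_nonneg_weights hℱ hfm hfb hf hImF hImb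
  have hReI : ∫ ω, |(W ω).re| ∂P ≤ M := by
    have h := integral_mono_of_nonneg (μ := P) (Eventually.of_forall fun ω => abs_nonneg ((W ω).re)) (integrable_const M)
      (Eventually.of_forall hReb)
    simpa using h
  have hImI : ∫ ω, |(W ω).im| ∂P ≤ M := by
    have h := integral_mono_of_nonneg (μ := P) (Eventually.of_forall fun ω => abs_nonneg ((W ω).im)) (integrable_const M)
      (Eventually.of_forall hImb)
    simpa using h
  -- integrability of the real pieces
  have hInt : ∀ {g : Ω → ℝ} {Cg : ℝ}, Measurable g → (∀ ω, |g ω| ≤ Cg) → Integrable g P :=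
    fun {g Cg} hg hgb => (integrable_const Cg).mono' hg.aestronglyMeasurable
      (Eventually.of_forall fun ω => by rw [Real.norm_eq_abs]; exact hgb ω)
  have hRem : Measurable fun ω => (W ω).re := Complex.measurable_re.comp hWm
  have hImm : Measurable fun ω => (W ω).im := Complex.measurable_im.comp hWm
  have iRe : Integrable (fun ω => (W ω).re * f ω) P := hInt (hRem.mul hfm) fun ω => by
    rw [abs_mul]; exact mul_le_mul (hReb ω) (hfb ω) (abs_nonneg _) ((abs_nonneg _).trans (hReb ω))
  have iIm : Integrable (fun ω => (W ω).im * f ω) P := hInt (hImm.mul hfm) fun ω => by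
    rw [abs_mul]; exact mul_le_mul (hImb ω) (hfb ω) (abs_nonneg _) ((abs_nonneg _).trans (hImb ω))
  -- decomposition of the complex integral
  have hpt : ∀ ω, W ω * (f ω : ℂ) = (((W ω).re * f ω : ℝ) : ℂ) + (((W ω).im * f ω : ℝ) : ℂ) * Complex.I := fun ω => by
    have hw := (Complex.re_add_im (W ω)).symm
    rw [hw]
    push_cast
    simp only [Complex.add_re, Complex.ofReal_re, Complex.mul_re, Complex.I_re, Complex.ofReal_im, Complex.I_im,
      Complex.add_im, Complex.mul_im, mul_zero, mul_one, add_zero, zero_add, sub_self]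
    ring
  have iRe' : Integrable (fun ω => (((W ω).re * f ω : ℝ) : ℂ)) P := iRe.ofReal
  have iIm' : Integrable (fun ω => (((W ω).im * f ω : ℝ) : ℂ) * Complex.I) P := iIm.ofReal.mul_const _
  rw [integral_congr_ae (ae_of_all _ hpt), integral_add iRe' iIm', integral_mul_const, integral_complex_ofReal,
    integral_complex_ofReal]
  calc ‖((∫ ω, (W ω).re * f ω ∂P : ℝ) : ℂ) + ((∫ ω, (W ω).im * f ω ∂P : ℝ) : ℂ) * Complex.I‖
      ≤ ‖((∫ ω, (W ω).re * f ω ∂P : ℝ) : ℂ)‖ + ‖((∫ ω, (W ω).im * f ω ∂P : ℝ) : ℂ) * Complex.I‖ := norm_add_le _ _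
    _ = |∫ ω, (W ω).re * f ω ∂P| + |∫ ω, (W ω).im * f ω ∂P| := by
        rw [norm_mul, Complex.norm_I, mul_one, Complex.norm_real, Complex.norm_real, Real.norm_eq_abs, Real.norm_eq_abs]
    _ ≤ η * ∫ ω, |(W ω).re| ∂P + η * ∫ ω, |(W ω).im| ∂P := add_le_add h1 h2
    _ ≤ η * M + η * M := add_le_add (mul_le_mul_of_nonneg_left hReI hη) (mul_le_mul_of_nonneg_left hImI hη)
    _ = 2 * η * M := by ring

end Summit.QuantumFields.YangMills.Theorems.ColdStartUniversality

end
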